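import Summits.ResolutionOfSingularities.ResolutionOfSingularities.Theorems.UniformComplexityPrimeModelTransferSpecializationBaseChange
import Literature.AlgebraicGeometry.Resolution.AlterationsDimension
import Literature.RingTheory.KrullDimension.BaseChangeKrullDim
import HarnessLib

/-!
# Crux `PrimeModelTransfer` (stmt-ResolutionOfSingularities-8933), door 2 of slot W8.2:
# DIMENSION-GRADED SPECIALIZATION (`Res_{≤ n}(L) ⇒ Res_{≤ n}(K)`)

Route `ResolutionOfSingularities/UniformComplexity`. The slot's OURS statements are GRADED BY
DIMENSION (`CampaignW82.…DimLe p m n`, res-L1-type-o6); this file grades the specialization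
theorem accordingly:

* `topologicalKrullDim_baseChange_eq` — for `X` integral and locally of finite type over a field
  `K` and a field extension `L` with `X ×_K L` integral, `dim (X ×_K L) = dim X` (Görtz–Wedhorn I
  Prop. 5.38, from the tree's affine form `Literature.RingTheory.KrullDimension.ringKrullDim_eq_of_isPushout_of_finiteType`
  and `Resolution.topologicalKrullDim_eq_ringKrullDim_of_isAffineOpen`);
* `hasResolution_of_isProper_of_resUpToDim_extension` — `K` algebraically closed, `L ⊇ K` perfect
  with resolution of all integral separated finite-type `L`-schemes of dimension `≤ n`: every
  integral `X` proper over `K` of dimension `≤ n` has a resolution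
  (`hasResolution_of_hasResolution_baseChange` applied to `X_L`, of dimension `dim X ≤ n`);
* `hasResolution_of_forall_proper_upToDim`, `integralResUpToDim_of_integralResUpToDim_extension` —
  the same for integral SEPARATED finite-type `X` of dimension `≤ n` (Nagata: a dense
  compactification of an integral scheme of finite type has the same dimension,
  `Resolution.topologicalKrullDim_eq_of_isOpenImmersion`).

[OURS · LADDER-RESOLUTION L1, slot W8.2 (prime-field / universality transfer), door 2
UniformComplexity] Theorems over the summit's own route; NOT statements of, and attributing
nothing to, Hironaka's 2017 manuscript. AI-written; weaker than expert review.

Sources: U. Görtz, T. Wedhorn, *Algebraic Geometry I* (2nd ed. 2020), Prop. 5.38, Thm. 5.22;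
B. Conrad, *Deligne's notes on Nagata compactifications* (2007), Thm. 4.1.
[cite: GortzWedhorn2020, Prop. 5.38] [cite: Conrad2007, Thm. 4.1]
-/

noncomputable section

set_option linter.dupNamespace false -- mandated namespace of this single-conjunct summit

open CategoryTheory CategoryTheory.Limits AlgebraicGeometry TopologicalSpace
open Literature.AlgebraicGeometry.Resolution
open scoped TensorProduct

namespace Summit.ResolutionOfSingularities.ResolutionOfSingularities.Theorems.PrimeModelTransfer

set_option backward.isDefEq.respectTransparency false

/-! ## Dimension is invariant under extension of the base field -/

/-- **`dim (X ×_K L) = dim X`** for `X` integral and locally of finite type over a field `K` and a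
field extension `L ⊇ K` such that `X ×_K L` is integral (Görtz–Wedhorn I, Prop. 5.38): on a
non-empty affine open `U ⊆ X`, `dim X = dim Γ(X, U)` and `dim X_L = dim Γ(X_L, U_L)` (Thm. 5.22 (1),
tree `Resolution.topologicalKrullDim_eq_ringKrullDim_of_isAffineOpen`), while
`Γ(X_L, U_L) = Γ(X, U) ⊗_K L` (Mathlib `isIso_pushoutSection_of_isAffineOpen`) has the dimension
of `Γ(X, U)` (tree `Literature.RingTheory.KrullDimension.ringKrullDim_eq_of_isPushout_of_finiteType`).
[cite: GortzWedhorn2020, Prop. 5.38] -/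
theorem topologicalKrullDim_baseChange_eq (K L : Type) [Field K] [Field L] [Algebra K L]
    {X X' : Scheme.{0}} {p : X ⟶ Spec (.of K)} {p' : X' ⟶ Spec (.of L)} {π : X' ⟶ X}
    (H : IsPullback π p' p (Spec.map (CommRingCat.ofHom (algebraMap K L))))
    [LocallyOfFiniteType p] [IsIntegral X] [IsIntegral X'] :
    topologicalKrullDim X' = topologicalKrullDim X := by
  classical
  haveI : LocallyOfFiniteType p' := MorphismProperty.of_isPullback H inferInstance
  haveI : Subsingleton ↥(Spec (CommRingCat.of K)) := inferInstanceAs (Subsingleton (PrimeSpectrum K))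
  haveI : Nonempty ↥(Spec (CommRingCat.of L)) := inferInstanceAs (Nonempty (PrimeSpectrum L))
  haveI : Surjective (Spec.map (CommRingCat.ofHom (algebraMap K L))) := inferInstance
  haveI : Surjective π := MorphismProperty.of_isPullback H.flip
    ‹Surjective (Spec.map (CommRingCat.ofHom (algebraMap K L)))›
  -- a non-empty affine open `U ⊆ X` and its (non-empty, affine) preimage
  obtain ⟨_, ⟨U, hU, rfl⟩, hξU, -⟩ :=
    X.isBasis_affineOpens.exists_subset_of_mem_open (Set.mem_univ (genericPoint X)) isOpen_univ
  have hUne : (U : Set X).Nonempty := ⟨_, hξU⟩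
  haveI : IsAffineHom π := MorphismProperty.of_isPullback H.flip inferInstance
  have hU' : IsAffineOpen (π ⁻¹ᵁ U) := hU.preimage π
  have hU'ne : ((π ⁻¹ᵁ U : X'.Opens) : Set X').Nonempty := by
    obtain ⟨x', hx'⟩ := π.surjective (genericPoint X)
    exact ⟨x', show π x' ∈ U by rw [hx']; exact hξU⟩
  rw [topologicalKrullDim_eq_ringKrullDim_of_isAffineOpen p' hU' hU'ne,
    topologicalKrullDim_eq_ringKrullDim_of_isAffineOpen p hU hUne]
  -- `Γ(X', π⁻¹U) = Γ(X, U) ⊗_K L` (pushout of sections over affine opens)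
  let φ : Γ(X, U) ⟶ Γ(X', π ⁻¹ᵁ U) := π.appLE U (π ⁻¹ᵁ U) le_rfl
  let ιk : CommRingCat.of K ⟶ Γ(Spec (CommRingCat.of K), ⊤) :=
    (Scheme.ΓSpecIso (CommRingCat.of K)).inv
  let ιL : CommRingCat.of L ⟶ Γ(Spec (CommRingCat.of L), ⊤) :=
    (Scheme.ΓSpecIso (CommRingCat.of L)).inv
  let fk : CommRingCat.of K ⟶ Γ(X, U) := ιk ≫ p.appLE ⊤ U le_top
  let gL : CommRingCat.of L ⟶ Γ(X', π ⁻¹ᵁ U) := ιL ≫ p'.appLE ⊤ (π ⁻¹ᵁ U) le_top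
  letI : Algebra Γ(X, U) Γ(X', π ⁻¹ᵁ U) := φ.hom.toAlgebra
  letI : Algebra K Γ(X, U) := fk.hom.toAlgebra
  letI : Algebra L Γ(X', π ⁻¹ᵁ U) := gL.hom.toAlgebra
  letI : Algebra K Γ(X', π ⁻¹ᵁ U) := (φ.hom.comp fk.hom).toAlgebra
  haveI : IsScalarTower K Γ(X, U) Γ(X', π ⁻¹ᵁ U) := IsScalarTower.of_algebraMap_eq fun _ ↦ rfl
  have happTop : ∀ {Y Z : Scheme.{0}} (g : Y ⟶ Z), g.appLE ⊤ ⊤ le_top = g.appTop := by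
    intro Y Z g
    rw [Scheme.Hom.appTop, Scheme.Hom.app_eq_appLE]
    rfl
  have happ : ∀ {g₁ g₂ : X' ⟶ Spec (CommRingCat.of K)} (_ : g₁ = g₂)
      (h₁ : π ⁻¹ᵁ U ≤ g₁ ⁻¹ᵁ ⊤) (h₂ : π ⁻¹ᵁ U ≤ g₂ ⁻¹ᵁ ⊤),
      g₁.appLE ⊤ (π ⁻¹ᵁ U) h₁ = g₂.appLE ⊤ (π ⁻¹ᵁ U) h₂ := by
    rintro g₁ _ rfl _ _
    rfl
  have hsq : fk ≫ φ = CommRingCat.ofHom (algebraMap K L) ≫ gL := by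
    have h1 : fk ≫ φ = ιk ≫ (π ≫ p).appLE ⊤ (π ⁻¹ᵁ U) le_top := by
      simp only [fk, φ, Category.assoc, Scheme.Hom.appLE_comp_appLE]
    have h2 : CommRingCat.ofHom (algebraMap K L) ≫ gL =
        ιk ≫ (p' ≫ Spec.map (CommRingCat.ofHom (algebraMap K L))).appLE ⊤ (π ⁻¹ᵁ U) le_top := by
      simp only [gL, ιL, ιk, ← Category.assoc]
      rw [Scheme.ΓSpecIso_inv_naturality, Category.assoc, ← happTop, Scheme.Hom.appLE_comp_appLE]
    rw [h1, h2, happ H.w]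
  have hsq' : φ.hom.comp fk.hom = gL.hom.comp (algebraMap K L) := by
    have := congrArg CommRingCat.Hom.hom hsq
    simpa only [CommRingCat.hom_comp, CommRingCat.hom_ofHom] using this
  haveI : IsScalarTower K L Γ(X', π ⁻¹ᵁ U) :=
    IsScalarTower.of_algebraMap_eq fun a ↦ congr($hsq' a)
  haveI : Algebra.IsPushout K Γ(X, U) L Γ(X', π ⁻¹ᵁ U) := by
    have hUY : π ⁻¹ᵁ U = π ⁻¹ᵁ U ⊓ p' ⁻¹ᵁ ⊤ := by simp
    have hiso := isIso_pushoutSection_of_isAffineOpen H (US := ⊤) (UT := ⊤) (UX := U)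
      le_top le_top hUY (isAffineOpen_top _) (isAffineOpen_top _) hU
    have hpo := (isIso_pushoutSection_iff H (US := ⊤) (UT := ⊤) (UX := U) le_top le_top hUY).mp
      hiso
    have hpo' : IsPushout fk (CommRingCat.ofHom (algebraMap K L)) φ gL := by
      refine hpo.of_iso (Scheme.ΓSpecIso (CommRingCat.of K)) (Iso.refl _)
        (Scheme.ΓSpecIso (CommRingCat.of L)) (Iso.refl _) ?_ ?_ ?_ ?_
      · simp [fk, ιk]
      · rw [happTop]
        exact Scheme.ΓSpecIso_naturality _
      · simp [φ]
      · simp [gL, ιL]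
    exact (CommRingCat.isPushout_iff_isPushout (R := K) (S := L) (R' := Γ(X, U))
      (S' := Γ(X', π ⁻¹ᵁ U))).mp hpo'
  -- `Γ(X, U)` is of finite type over `K`
  haveI : Algebra.FiniteType K Γ(X, U) := by
    have h1 : (p.appLE ⊤ U le_top).hom.FiniteType :=
      HasRingHomProperty.appLE @LocallyOfFiniteType p inferInstance ⟨⊤, isAffineOpen_top _⟩
        ⟨U, hU⟩ le_top
    have h2 : fk.hom.FiniteType := by
      change ((p.appLE ⊤ U le_top).hom.comp ιk.hom).FiniteType
      exact h1.comp (RingHom.FiniteType.of_surjective _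
        (Scheme.ΓSpecIso (CommRingCat.of K)).symm.commRingCatIsoToRingEquiv.surjective)
    exact h2
  exact Literature.RingTheory.KrullDimension.ringKrullDim_eq_of_isPushout_of_finiteType
    (k := K) (L := L) (R := Γ(X, U)) (R' := Γ(X', π ⁻¹ᵁ U))

/-! ## Graded specialization -/

/-- **GRADED SPECIALIZATION, proper case: `Res_{≤ n}(L) ⇒ Res_{≤ n}(K)` on proper `X`.** Let `K`
be algebraically closed, `L ⊇ K` perfect such that every integral separated scheme of finite type
over `L` of dimension `≤ n` has a resolution, and `X → Spec K` proper with `X` integral of dimension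
`≤ n`. Then `X` has a resolution: `X_L` is integral of dimension `dim X ≤ n`
(`topologicalKrullDim_baseChange_eq`), hence resolvable, and `hasResolution_of_hasResolution_baseChange`
specialises its resolution. [cite: GortzWedhorn2020, Prop. 5.38] -/
theorem hasResolution_of_isProper_of_resUpToDim_extension (K : Type) [Field K] [IsAlgClosed K]
    (L : Type) [Field L] [Algebra K L] [PerfectField L] (n : WithBot ℕ∞)
    (hL : ∀ (X : Scheme.{0}) (f : X ⟶ Spec (.of L)), IsSeparated f → LocallyOfFiniteType f →
      QuasiCompact f → IsIntegral X → topologicalKrullDim X ≤ n → Scheme.HasResolution X)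
    (X : Scheme.{0}) (f : X ⟶ Spec (.of K)) [IsProper f] [IsIntegral X]
    (hX : topologicalKrullDim X ≤ n) : Scheme.HasResolution X := by
  let i : Spec (.of L) ⟶ Spec (.of K) := Spec.map (CommRingCat.ofHom (algebraMap K L))
  haveI : IsIntegral (pullback f i : Scheme.{0}) :=
    (Literature.AlgebraicGeometry.Motives.geometricallyIntegral_of_isAlgClosed (k := K) f)
      |>.geometrically_isIntegral i (pullback.fst f i) (pullback.snd f i)
        (IsPullback.of_hasPullback f i)
  refine hasResolution_of_hasResolution_baseChange K L X f
    (hL _ (pullback.snd f i) inferInstance inferInstance inferInstance inferInstance ?_)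
  rw [topologicalKrullDim_baseChange_eq K L (IsPullback.of_hasPullback f i)]
  exact hX

/-- **Graded Nagata reduction**: if every integral `K`-scheme PROPER over `K` of dimension `≤ n`
has a resolution, so does every integral separated `K`-scheme of finite type of dimension `≤ n`
(a dense compactification of an integral scheme of finite type is integral of the same dimension,
`Resolution.topologicalKrullDim_eq_of_isOpenImmersion`; then restrict,
`Scheme.HasResolution.of_isOpenImmersion`). [cite: Conrad2007, Thm. 4.1 and Remark 4.2] -/
theorem hasResolution_of_forall_proper_upToDim (K : Type) [Field K] (n : WithBot ℕ∞)
    (h : ∀ (X : Scheme.{0}) (f : X ⟶ Spec (.of K)), IsProper f → IsIntegral X →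
      topologicalKrullDim X ≤ n → Scheme.HasResolution X)
    (X : Scheme.{0}) (f : X ⟶ Spec (.of K)) [IsSeparated f] [LocallyOfFiniteType f]
    [QuasiCompact f] [IsIntegral X] (hX : topologicalKrullDim X ≤ n) :
    Scheme.HasResolution X := by
  obtain ⟨Xc, j, g, hj, hjd, hjsd, hg, hfac⟩ :=
    Literature.AlgebraicGeometry.Morphisms.NagataCompactification.exists_dense
      Literature.AlgebraicGeometry.Morphisms.NagataCompactification_holds X (Spec (.of K)) f
  haveI := hj; haveI := hjd; haveI := hjsd; haveI := hg
  haveI : QuasiCompact (j ≫ g) := hfac ▸ inferInstance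
  haveI : QuasiCompact j := .of_comp j g
  haveI : IsReduced Xc := IsSchemeTheoreticallyDominant.isReduced j
  haveI : IrreducibleSpace Xc := by
    have h1 : IsIrreducible (Set.range j) := by
      rw [← Set.image_univ]
      exact (IrreducibleSpace.isIrreducible_univ X).image _ j.continuous.continuousOn
    have h2 := h1.closure
    rw [j.denseRange.closure_range] at h2
    exact (irreducibleSpace_def Xc).mpr h2
  haveI : IsIntegral Xc := isIntegral_of_irreducibleSpace_of_isReduced Xc
  have hdim : topologicalKrullDim Xc ≤ n := by
    rw [← topologicalKrullDim_eq_of_isOpenImmersion g j]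
    exact hX
  exact (h Xc g hg inferInstance hdim).of_isOpenImmersion j

/-- **GRADED SPECIALIZATION: `Res_{≤ n}(L) ⇒ Res_{≤ n}(K)`** for `K` algebraically closed and
`L ⊇ K` perfect: if every integral separated scheme of finite type over `L` of dimension `≤ n` has
a resolution, then so does every integral separated scheme of finite type over `K` of dimension
`≤ n`. (In the graded bookkeeping of slot W8.2: each rung of the door-2 residual ladder is
monotone under enlarging the algebraically closed constant field, and the graded crux hypothesis
`Res_{≤ n}(𝔽̄_p)` follows from `Res_{≤ n}(M)` for any algebraically closed `M` of
characteristic `p`.) [cite: GortzWedhorn2020, Prop. 5.38] -/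
theorem integralResUpToDim_of_integralResUpToDim_extension (K : Type) [Field K] [IsAlgClosed K]
    (L : Type) [Field L] [Algebra K L] [PerfectField L] (n : WithBot ℕ∞)
    (hL : ∀ (X : Scheme.{0}) (f : X ⟶ Spec (.of L)), IsSeparated f → LocallyOfFiniteType f →
      QuasiCompact f → IsIntegral X → topologicalKrullDim X ≤ n → Scheme.HasResolution X)
    (X : Scheme.{0}) (f : X ⟶ Spec (.of K)) (hs : IsSeparated f) (hl : LocallyOfFiniteType f)
    (hq : QuasiCompact f) (hX : IsIntegral X) (hdim : topologicalKrullDim X ≤ n) :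
    Scheme.HasResolution X :=
  hasResolution_of_forall_proper_upToDim K n
    (fun Y g _ _ hY => hasResolution_of_isProper_of_resUpToDim_extension K L n hL Y g hY) X f hdim

/-- **Graded monotonicity of the residual ladder** (subfield form): inside a field `K`, for
subfields `M₁ ≤ M₂` with `M₁` algebraically closed and `M₂` perfect, resolution in dimension
`≤ n` over `M₂` implies resolution in dimension `≤ n` over `M₁`. [folklore] -/
theorem integralResUpToDim_subfield_of_subfield {K : Type} [Field K] (M₁ M₂ : Subfield K)
    (h12 : M₁ ≤ M₂) [IsAlgClosed M₁] [PerfectField M₂] (n : WithBot ℕ∞)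
    (hM₂ : ∀ (X : Scheme.{0}) (f : X ⟶ Spec (.of M₂)), IsSeparated f → LocallyOfFiniteType f →
      QuasiCompact f → IsIntegral X → topologicalKrullDim X ≤ n → Scheme.HasResolution X)
    (X : Scheme.{0}) (f : X ⟶ Spec (.of M₁)) (hs : IsSeparated f) (hl : LocallyOfFiniteType f)
    (hq : QuasiCompact f) (hX : IsIntegral X) (hdim : topologicalKrullDim X ≤ n) :
    Scheme.HasResolution X := by
  letI : Algebra M₁ M₂ := (Subfield.inclusion h12).toAlgebra
  exact integralResUpToDim_of_integralResUpToDim_extension M₁ M₂ n hM₂ X f hs hl hq hX hdim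

end Summit.ResolutionOfSingularities.ResolutionOfSingularities.Theorems.PrimeModelTransfer

end
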